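/-
Copyright (c) 2026 the pub-hodgecm-mathlib formalisation cell (harness21).  Prover seat hodgecm-mathlib-F0P2-p02 (g26); E1 keeper ∕ dealer F0P3a-p03 (g29), E1 BRICK
LEDGER row 46 D′46 «K4′ SELF-EXTENSION ASSEMBLY modulo JET @ DATUM» (census `F0/P2/p02/g26/k4prime/CENSUS-K4PRIME-SELFEXT.v1` ec9d9e16; generic heart ★ G3 p853276).
-/
import Literature.RepresentationTheory.SelfExtensionSplittingOfJetSign                   -- ★ row 46 G3 (this seat): `exists_section_of_two_le_finrank_or_exists_jet_of_jet_intertwiner`, `…_or_exists_jet_sign`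
import Summits.HodgeConjecture.HodgeConjecture.Theorems.F0P3cStCharTSK2PiTwoSelfExtSplit  -- ★ row 40 D (F0P3b-p01 (g25)): (D1) `two_le_finrank_intertwiningMap_normalizedInd_of_jacquet`, (F) `exists_equivariant_jet_of_jacquet_sub` (brings ★ FN, ★ J1∕J2, `cmBorelTriple`)
import HarnessLib

/-!
# K4′: a smooth self-extension of `π⁺ = ker(𝒜₀ − 1) ⊂ i_B(θ̃)` SPLITS, given a jet intertwiner `(𝒜₀, 𝒜₁)` and the Jacquet alternative — the DATUM FORK of ★ G3, read through Frobenius (★ D)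

Cell `pub/hodgecm-mathlib`, crux H413 = `stmt-HodgeConjecture-24833` (`--supports` lane, helper, THEOREMS ONLY: no definition ∕ instance ∕ notation ∕ named fact ∕ `sorry`).
Namespace `Summit.HodgeConjecture.HodgeConjecture.Cruxes.H413.F0P3cStCharTSK4PrimeSelfExtSplit`.  E1 BRICK LEDGER (F0P3a-p03 (g29)) row 46 — the K4′ cell's twin of row 40 D: «every
smooth self-extension of `π⁺` SPLITS, modulo the JET EXISTENCE `(𝒜₀, 𝒜₁)`» (RESIDUE MATRIX v1.1 K4′ line, MEMO «K4′ SPINE WITHOUT Ext» v2; generic heart ★ G3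
`SelfExtensionSplittingOfJetSign`, Frobenius fork ★ D `F0P3cStCharTSK2PiTwoSelfExtSplit` (D1)∕(F)).  Seat F0P2-p02 (g26).

THE MATHEMATICS (letters of ★ D §1 VERBATIM).  `G ⊇ P = MN` a parabolic triple `t` (`[LocallyCompactSpace P]`, `δ_P|_N = 1` — `hδ`; at the CM datum `t := cmBorelTriple L N v`,
`G = U(Φ_N)(L⁺_v)`, `hδ` = ★ `deltaChar_cmBorelTriple_eq_one_of_mem_N`), `σ₀` on `W₀` (`σ₀ = θ̃`, a unitary `w`-fixed character, for K4′), `I₀ := i_P(σ₀) = normalizedInd t σ₀` on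
`V := SmoothInd t.P (σ₀ ∘ proj ⊗ δ^{1/2})`, `N₀ = σ₀ ⊗ [[1, λ],[0, 1]]` on `W₀ × W₀` (`hN₀`; sub `0 × W₀`, quotient = first coordinate), a height `Λ` of `λ` (`hΛ`, `KΛ`, `hΛK` — ★ H2 at the
datum) and ANY height-jet pair `(π₁, ρ)` (`hπ₁`, `hρ`) of `(I₀, Λ)` (★ J2 supplies one).  NEW for K4′, hypothesis-style: a JET INTERTWINER `(𝒜₀, 𝒜₁)` for `(I₀, π₁)` —
`hA₀ : 𝒜₀ ∘ I₀(g) = I₀(g) ∘ 𝒜₀`, `hA₁ : 𝒜₁ I₀(g) − I₀(g) 𝒜₁ = −(π₁ g 𝒜₀ + 𝒜₀ π₁ g)` (★ JET-SIGN's letters; **(J)**, the ONE analytic sentence of the K4′ cell: the normalised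
intertwining operator `𝒜(w, θ̃ν^s)` is holomorphic and non-scalar at `s = 0`, [Keys1984 §3–§4] — PRINT, never discharged; since `π₁ = π₁^Λ` is a binder, `(J)` is asked for THE `λ`
of the extension at hand = the keeper's (J∀) 02:11:49Z) — and the constituent `A = π⁺` with `𝒜₀ = 1` on `A` (`hAfix : ∀ a ∈ A, 𝒜₀ a = a`), invariant, irreducible, with
`Hom_G(A, I₀ ∕ A) = 0` («`Hom(π⁺, π⁻) = 0`») and Schur ((d1′), PRINT [Keys1984 §4 Thm. 3; Rogawski1990 §12.2]).  For a SMOOTH self-extension `0 → A —ι→ τ —p→ A → 0` with `r_P τ`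
finite-dimensional:
* §1 **`exists_section_selfExtension_of_jacquet_alternative_of_jet_intertwiner`** (abstract triple): IF the JACQUET ALTERNATIVE (d1′) holds — `2 ≤ dim Hom_M(r_P τ, σ₀)`
  («`r_P τ ≅ θ̃ ⊕ θ̃`») OR some `M`-map `θ : r_P τ → N₀` misses the sub (`∃ y, (θ y).1 ≠ 0`) while `θ ∘ r_P(ι)` lands in the sub and is non-zero («`r_P τ ≅ N_λ`», with `r_P(ι)(r_P A)`
  the stable line) — then **`p` has an equivariant section: `τ` SPLITS.**  Proof: ★ G3 `exists_section_of_two_le_finrank_or_exists_jet_of_jet_intertwiner` at `π₀ := I₀` fed with ★ D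
  (D1) (branch 1) ∕ ★ D (F) (branch 2: the SAME `φ = Ψ ∘ E⁻¹θ` meets the quotient AND the sub); `Hom_G(τ, I₀)` is finite-dimensional by the normalised Frobenius equivalence `E` (★ FN)
  and Mathlib's `Module.Finite (IntertwiningMap · ·)` from `r_P τ`, `W₀` finite-dimensional.  Twin with the jet sign `Φ` abstract: `…_of_jet_sign`.
* §2 AT THE CM DATUM: the assembly is applied by ONE partial application `… (cmBorelTriple L N v) (deltaChar_cmBorelTriple_eq_one_of_mem_N L N v) …` inside the consumer's proof —
  re-spelling the statement with `(normalizedInd (cmBorelTriple …) σ₀).subrepresentation A hAinv` in the binders hits the whnf wall measured by ★ J2 §3 ∕ ★ JW ∕ ★ D (D4); the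
  HOME cert `F0/P2/p02/g26/k4prime/CERT.datum.K1.F0P2p02g26.lean` records the kernel-checked instantiation.
INPUTS CARRIED VERBATIM AS HYPOTHESES (PRINT, not discharged here): (J) `(𝒜₀, 𝒜₁)` [Keys1984 §3 pp. 118–119, §4 Thm. 3]; (d1′) `hAfix`, `hAirr`, `hHom0`, `hSchur` for `A = π⁺ ⊂ i_B(θ̃)`
[Keys1984 §4; Rogawski1990 §12.2 (3)]; the Jacquet alternative `hJ` with its sub-line clauses — from `r_B` exact ★, `r_B π⁺` a `θ̃`-line [Keys1984] and ★ CHAR-EXT B ∕ ★ LENGTH-TWO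
(the unique stable line of the non-split `N_λ`) — a later rider (row 40′-type brick), not this file.
[cite: Keys1984, §3 pp. 118–119; §4 Thm. 3 p. 120] [cite: BernsteinZelevinsky1977, Proposition 1.9(b), p. 445; §2.3] [cite: Casselman1995, §3.2; §6.3] [cite: Rogawski1990, §12.2 p. 173]
HONEST LABEL: count-neutral datum assembly modulo (J), (d1′); the K4′ cell moves only at a desk-priced rider; h413 OPEN; HC_CM is proved only modulo the 7 printed citations (2 remaining
named inputs hLiu418 = stmt-HodgeConjecture-24832, h413 = stmt-HodgeConjecture-24833) until rung 0 closes.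

## References
* [Keys1984] D. Keys, *Principal series representations of special unitary groups over local fields*, Compositio Math. 51 (1984), §3 pp. 118–119, §4 Thm. 3 p. 120.
* [BernsteinZelevinsky1977] I. N. Bernstein, A. V. Zelevinsky, *Induced representations of reductive p-adic groups I*, Ann. Sci. ÉNS 10 (1977), Prop. 1.9 (b) p. 445, §2.3.
* [Casselman1995] W. Casselman, *Introduction to the theory of admissible representations of p-adic reductive groups* (1995), §3.2, §6.3.
* [Rogawski1990] J. D. Rogawski, *Automorphic Representations of Unitary Groups in Three Variables*, Ann. of Math. Stud. 123 (1990), §12.2 p. 173.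
-/

set_option autoImplicit false

set_option linter.dupNamespace false

noncomputable section

open NumberField IsDedekindDomain

namespace Summit.HodgeConjecture.HodgeConjecture.Cruxes.H413.F0P3cStCharTSK4PrimeSelfExtSplit

open Literature.NumberTheory.Automorphic Literature.NumberTheory.Automorphic.UnitaryGroup Representation Literature.RepresentationTheory
open Summit.HodgeConjecture.HodgeConjecture.Cruxes.H413

/-! ## §1 Any parabolic triple `t` with `δ_P|_N = 1` -/

section AnyTriple

variable {G : Type*} [Group G] [TopologicalSpace G] [IsTopologicalGroup G] (t : ParabolicTriple G) [LocallyCompactSpace ↥t.P]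
  (hδ : ∀ (n : G) (hn : n ∈ t.N), deltaChar t.P ⟨n, t.N_le hn⟩ = 1)
  {W₀ : Type*} [AddCommGroup W₀] [Module ℂ W₀] (σ₀ : Representation ℂ ↥t.M W₀)
  {X : Type*} [AddCommGroup X] [Module ℂ X] (τ : Representation ℂ G X)
  (lam : ↥t.M → ℂ) (N₀ : Representation ℂ ↥t.M (W₀ × W₀))
  (hN₀ : ∀ (m : ↥t.M) (w : W₀ × W₀), N₀ m w = (σ₀ m w.1, lam m • σ₀ m w.1 + σ₀ m w.2))
  (Λ : G → ℂ) (hΛ : ∀ (p : ↥t.P) (g : G), Λ ((p : G) * g) = lam (t.proj p) + Λ g)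
  (KΛ : Subgroup G) (hKΛ : IsOpen (KΛ : Set G)) (hΛK : ∀ (x κ : G), κ ∈ KΛ → Λ (x * κ) = Λ x)
  (π₁ : G → Module.End ℂ (SmoothInd t.P (Representation.twist (σ₀.comp t.proj) (rootDeltaChar t.P))))
  (hπ₁ : ∀ (g : G) (w : SmoothInd t.P (Representation.twist (σ₀.comp t.proj) (rootDeltaChar t.P))) (x : G),
    (π₁ g w).toFun x = (Λ (x * g) - Λ x) • w.toFun (x * g))
  (ρ : Representation ℂ G (SmoothInd t.P (Representation.twist (σ₀.comp t.proj) (rootDeltaChar t.P)) ×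
    SmoothInd t.P (Representation.twist (σ₀.comp t.proj) (rootDeltaChar t.P))))
  (hρ : ∀ g v₀ v₁, ρ g (v₀, v₁) = (Representation.normalizedInd t σ₀ g v₀, π₁ g v₀ + Representation.normalizedInd t σ₀ g v₁))

include hδ in
/-- **`Hom_G(τ, i_P σ₀)` IS FINITE-DIMENSIONAL when `r_P τ` and `W₀` are**: the normalised Frobenius equivalence `E : Hom_G(τ, i_P σ₀) ≃ₗ Hom_M(r_P τ, σ₀)` (★ FN) and Mathlib's
`Module.Finite (IntertwiningMap · ·)`. [cite: BernsteinZelevinsky1977, Proposition 1.9(b), p. 445] [cite: Casselman1995, §3.2] -/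
theorem finiteDimensional_intertwiningMap_normalizedInd_of_jacquet (hτ : τ.IsSmooth)
    [FiniteDimensional ℂ (t.restrict τ).Coinvariants] [FiniteDimensional ℂ W₀] :
    FiniteDimensional ℂ (IntertwiningMap τ (Representation.normalizedInd t σ₀)) :=
  Module.Finite.equiv ((frobeniusEquiv (H := t.P) (σ := Representation.twist (σ₀.comp t.proj) (rootDeltaChar t.P)) hτ).trans
    (normalizedJacquetHomEquiv t τ σ₀ hδ)).symm

include hδ hN₀ hΛ hKΛ hΛK hπ₁ hρ in
/-- **K4′: A SELF-EXTENSION OF `A ⊂ i_P(σ₀)` SPLITS, GIVEN A JET SIGN AND THE JACQUET ALTERNATIVE** (jet sign abstract).  Let `Φ ∈ End_G(ρ)` act by `+1` over `A` on the quotient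
(`hΦfst`) and by `−1` on the sub copy of `A` (`hΦsub`); `A ≤ I₀` invariant, irreducible, `Hom_G(A, I₀ ∕ A) = 0`, Schur; `0 → A —ι→ τ —p→ A → 0` a SMOOTH self-extension with `r_P τ`
finite-dimensional.  If `2 ≤ dim Hom_M(r_P τ, σ₀)` OR some `θ : r_P τ → N₀` misses the sub while `θ ∘ r_P(ι)` lands in the sub and is non-zero, then `p` has an equivariant section.
★ G3 `exists_section_of_two_le_finrank_or_exists_jet_sign` ∘ ★ D (D1)∕(F). [cite: Keys1984, §3 pp. 118–119; §4 Thm. 3 p. 120] [cite: BernsteinZelevinsky1977, Proposition 1.9(b), p. 445; §2.3]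
[cite: Rogawski1990, §12.2 p. 173] -/
theorem exists_section_selfExtension_of_jacquet_alternative_of_jet_sign (hτ : τ.IsSmooth)
    [FiniteDimensional ℂ (t.restrict τ).Coinvariants] [FiniteDimensional ℂ W₀]
    (A : Submodule ℂ (SmoothInd t.P (Representation.twist (σ₀.comp t.proj) (rootDeltaChar t.P))))
    (hAinv : ∀ g, A ≤ A.comap (Representation.normalizedInd t σ₀ g))
    (hAirr : ∀ B : Submodule ℂ (SmoothInd t.P (Representation.twist (σ₀.comp t.proj) (rootDeltaChar t.P))), B ≤ A →
      (∀ g, B ≤ B.comap (Representation.normalizedInd t σ₀ g)) → B = ⊥ ∨ B = A)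
    (hHom0 : ∀ ψ : IntertwiningMap ((Representation.normalizedInd t σ₀).subrepresentation A hAinv) ((Representation.normalizedInd t σ₀).quotient A hAinv), ψ = 0)
    (hSchur : Module.finrank ℂ (IntertwiningMap ((Representation.normalizedInd t σ₀).subrepresentation A hAinv)
      ((Representation.normalizedInd t σ₀).subrepresentation A hAinv)) = 1)
    (Φ : IntertwiningMap ρ ρ)
    (hΦfst : ∀ v : SmoothInd t.P (Representation.twist (σ₀.comp t.proj) (rootDeltaChar t.P)) × SmoothInd t.P (Representation.twist (σ₀.comp t.proj) (rootDeltaChar t.P)),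
      v.1 ∈ A → (Φ v).1 = v.1)
    (hΦsub : ∀ w ∈ A, Φ (0, w) = (0, -w))
    (ι : IntertwiningMap ((Representation.normalizedInd t σ₀).subrepresentation A hAinv) τ)
    (p : IntertwiningMap τ ((Representation.normalizedInd t σ₀).subrepresentation A hAinv))
    (hp : Function.Surjective p) (hexact : LinearMap.ker p.toLinearMap = LinearMap.range ι.toLinearMap)
    (hJ : 2 ≤ Module.finrank ℂ (IntertwiningMap (τ.normalizedJacquet t) σ₀) ∨
      ∃ θ : IntertwiningMap (τ.normalizedJacquet t) N₀, (∃ y, (θ y).1 ≠ 0) ∧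
        (∀ a : A, (θ (Coinvariants.mk (t.restrict τ) (ι a))).1 = 0) ∧ ∃ a : A, θ (Coinvariants.mk (t.restrict τ) (ι a)) ≠ 0) :
    ∃ s : IntertwiningMap ((Representation.normalizedInd t σ₀).subrepresentation A hAinv) τ,
      p.comp s = IntertwiningMap.id ((Representation.normalizedInd t σ₀).subrepresentation A hAinv) := by
  haveI := finiteDimensional_intertwiningMap_normalizedInd_of_jacquet t hδ σ₀ τ hτ
  refine exists_section_of_two_le_finrank_or_exists_jet_sign (Representation.normalizedInd t σ₀) π₁ ρ hρ A two_ne_zero hAinv hAirr hHom0 hSchur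
    Φ hΦfst hΦsub τ ι p hp hexact ?_
  rcases hJ with h2 | ⟨θ, hθ, hsub, hne⟩
  · exact Or.inl (F0P3cStCharTSK2PiTwoSelfExtSplit.two_le_finrank_intertwiningMap_normalizedInd_of_jacquet t hδ σ₀ τ hτ h2)
  · obtain ⟨φ, hφ, h₀, hfst, a, ha⟩ := F0P3cStCharTSK2PiTwoSelfExtSplit.exists_equivariant_jet_of_jacquet_sub t hδ σ₀ τ lam N₀ hN₀ Λ hΛ KΛ hKΛ hΛK
      π₁ hπ₁ ρ hρ hτ ((Representation.normalizedInd t σ₀).subrepresentation A hAinv) ι θ hθ hsub hne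
    exact Or.inr ⟨φ, hφ, h₀, ι a, hfst a, ha⟩

include hδ hN₀ hΛ hKΛ hΛK hπ₁ hρ in
/-- **K4′-alg ⟸ (J): A SELF-EXTENSION OF `π⁺ ⊂ i_P(σ₀)` SPLITS, GIVEN THE JET INTERTWINER `(𝒜₀, 𝒜₁)` AND THE JACQUET ALTERNATIVE.**  `(𝒜₀, 𝒜₁)` a jet intertwiner for `(I₀, π₁)` (★ JET-SIGN
letters `hA₀`, `hA₁`; **(J)**, PRINT [Keys1984]), `A ≤ ker(𝒜₀ − 1)` (`hAfix`) invariant, irreducible, `Hom_G(A, I₀ ∕ A) = 0`, Schur ((d1′), PRINT); `0 → A —ι→ τ —p→ A → 0` a SMOOTH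
self-extension with `r_P τ` finite-dimensional.  If the JACQUET ALTERNATIVE holds — `2 ≤ dim Hom_M(r_P τ, σ₀)` («`r_P τ ≅ θ̃ ⊕ θ̃`») OR some `θ : r_P τ → N₀` misses the sub `0 × W₀`
while `θ ∘ r_P(ι)` lands in it and is non-zero («`r_P τ ≅ N_λ`», `r_P(ι)(r_P A)` the stable line) — then **`p` has an equivariant section: `τ` SPLITS.**
★ G3 `exists_section_of_two_le_finrank_or_exists_jet_of_jet_intertwiner` at `π₀ := normalizedInd t σ₀` ∘ ★ D (D1)∕(F).
[cite: Keys1984, §3 pp. 118–119; §4 Thm. 3 p. 120] [cite: BernsteinZelevinsky1977, Proposition 1.9(b), p. 445; §2.3] [cite: Casselman1995, §6.3] [cite: Rogawski1990, §12.2 p. 173] -/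
theorem exists_section_selfExtension_of_jacquet_alternative_of_jet_intertwiner (hτ : τ.IsSmooth)
    [FiniteDimensional ℂ (t.restrict τ).Coinvariants] [FiniteDimensional ℂ W₀]
    (A₀ A₁ : Module.End ℂ (SmoothInd t.P (Representation.twist (σ₀.comp t.proj) (rootDeltaChar t.P))))
    (hA₀ : ∀ g, A₀ * Representation.normalizedInd t σ₀ g = Representation.normalizedInd t σ₀ g * A₀)
    (hA₁ : ∀ g, A₁ * Representation.normalizedInd t σ₀ g - Representation.normalizedInd t σ₀ g * A₁ = -(π₁ g * A₀ + A₀ * π₁ g))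
    (A : Submodule ℂ (SmoothInd t.P (Representation.twist (σ₀.comp t.proj) (rootDeltaChar t.P)))) (hAfix : ∀ a ∈ A, A₀ a = a)
    (hAinv : ∀ g, A ≤ A.comap (Representation.normalizedInd t σ₀ g))
    (hAirr : ∀ B : Submodule ℂ (SmoothInd t.P (Representation.twist (σ₀.comp t.proj) (rootDeltaChar t.P))), B ≤ A →
      (∀ g, B ≤ B.comap (Representation.normalizedInd t σ₀ g)) → B = ⊥ ∨ B = A)
    (hHom0 : ∀ ψ : IntertwiningMap ((Representation.normalizedInd t σ₀).subrepresentation A hAinv) ((Representation.normalizedInd t σ₀).quotient A hAinv), ψ = 0)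
    (hSchur : Module.finrank ℂ (IntertwiningMap ((Representation.normalizedInd t σ₀).subrepresentation A hAinv)
      ((Representation.normalizedInd t σ₀).subrepresentation A hAinv)) = 1)
    (ι : IntertwiningMap ((Representation.normalizedInd t σ₀).subrepresentation A hAinv) τ)
    (p : IntertwiningMap τ ((Representation.normalizedInd t σ₀).subrepresentation A hAinv))
    (hp : Function.Surjective p) (hexact : LinearMap.ker p.toLinearMap = LinearMap.range ι.toLinearMap)
    (hJ : 2 ≤ Module.finrank ℂ (IntertwiningMap (τ.normalizedJacquet t) σ₀) ∨
      ∃ θ : IntertwiningMap (τ.normalizedJacquet t) N₀, (∃ y, (θ y).1 ≠ 0) ∧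
        (∀ a : A, (θ (Coinvariants.mk (t.restrict τ) (ι a))).1 = 0) ∧ ∃ a : A, θ (Coinvariants.mk (t.restrict τ) (ι a)) ≠ 0) :
    ∃ s : IntertwiningMap ((Representation.normalizedInd t σ₀).subrepresentation A hAinv) τ,
      p.comp s = IntertwiningMap.id ((Representation.normalizedInd t σ₀).subrepresentation A hAinv) := by
  obtain ⟨Φ, hΦfst, hΦsub⟩ := exists_jet_sign_of_jet_intertwiner (Representation.normalizedInd t σ₀) π₁ ρ hρ A₀ A₁ hA₀ hA₁ A hAfix
  exact exists_section_selfExtension_of_jacquet_alternative_of_jet_sign t hδ σ₀ τ lam N₀ hN₀ Λ hΛ KΛ hKΛ hΛK π₁ hπ₁ ρ hρ hτ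
    A hAinv hAirr hHom0 hSchur Φ hΦfst hΦsub ι p hp hexact hJ

end AnyTriple

end Summit.HodgeConjecture.HodgeConjecture.Cruxes.H413.F0P3cStCharTSK4PrimeSelfExtSplit

end
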